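import Summits.HodgeConjecture.HodgeConjecture.Theorems.VHCAbelianSchemesRoadDesignSufficient
import Summits.HodgeConjecture.HodgeConjecture.Theorems.VHCAbelianSchemesRoadDesignUntwist
import HarnessLib

/-!
# Road b02 (`VHCAbelianSchemesRoad`) — AN UNTWISTED SEMIREGULAR COMPLEX WITH `ch_p ≡ a·W| (mod ℚ·θᵖ)` AT ONE PICARD-RANK-ONE FIBRE IS A
# K-SR♭∃ DATUM: the cell `(4,2)` at a Picard-rank-one fibre, per fibre, `B`-field-free in BOTH directions

research route conditional on HC_CM; not a corollary; Q11.4-sentence-2 already refuted in dim ≥ 3.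

THEOREMS ONLY (no definition, no named fact, no sorry; `HC_CM` occurs nowhere). PART Z-e showed the NECESSARY side of the `(4,2)` cell is
untwisted (a bounded complex of vector bundles `E•`, AdmTw-admissible, with `ch₂(E•) = e^*(a·w + z')` on a copy). This file is the matching
SUFFICIENT side PER FIBRE: on a pencil of relative dimension `n` and a fibre `s₁` of Picard number one in Hodge form (w.r.t. `Θ|_{s₁}`, `Θ`
any global class with rational `(1,1)` restrictions) at which the algebraic classes of the middle side degrees are Lefschetz
(`Nʲ ⊆ Dʲ ⊗ ℂ`, `2 ≤ j ≤ n − 2`, `j ≠ p` — VACUOUS for `(n, p) = (4, 2)`), an `Adm`-admissible bounded complex of vector bundles `E•` on `𝒳_{s₁}`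
with `ch_p(E•) = a·W|_{s₁} + c·(Θ|_{s₁})ᵖ`, `a ≠ 0`, IS a K-SR♭∃ datum for the door `twistedReflexiveClass C Adm` (with `B₀ = 0`): every other
`ch_q(E•)` is automatically on the `θ`-ray (`H⁰ = ℂ·1`; Lefschetz `(1,1)`; hard Lefschetz for `q ≥ n − 1` — the tree's off-mid-range theorem —
and the displayed hypothesis in between), so PART Z-b §5's engine applies.

* §1 `exists_eq_smul_cupPowTwo_of_picardRankOne` — at such a fibre every rational ALGEBRAIC class of degree `2q`, `q` off the open mid-range
  slots, lies on `ℂ·θ^q`.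
* §2 **`exists_lefAtDatum_of_untwisted_at`** — the per-fibre engine in untwisted form (door `twistedReflexiveClass C Adm`, any `Adm`, any `(n,p)`,
  hypotheses `hpic` and `hN` at the ONE fibre `s₁`).
* §3 **`exists_lefAtDatum_of_untwisted_at_fourfold`** — `(n, p) = (4, 2)`: NO `hN` (the only mid-range slot is `p = 2` itself): «an AdmTw-admissible
  `E•` on a Picard-rank-one fibre `𝒳_{s₁}` of a fourfold pencil with `ch₂(E•) = a·W|_{s₁} + c·θ²`, `a ≠ 0`» ⟹ the `(4,2)` cell's conclusion for
  that pencil; with PART Z-e (`exists_untwisted_of_firstCell_fourfoldMiddleTw` + the pin): at Picard-rank-one fourfolds the cell's per-fibre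
  content is EXACTLY the untwisted statement `ch₂(E•) ≡ a·w (mod ℚ·θ²)`, `a ≠ 0` — sufficient at the fibre, necessary on a copy
  (`exists_untwisted_pinned_fourfold_of_firstCell_fourfoldMiddleTw`).

References: [cite: Bloch1972Semiregularity, Remark (7.5)] [cite: BuchweitzFlenner2003, §5 Thm. 5.1] [cite: vanGeemen1994HodgeAV, §2.4, Thm. 4.11
and Thm. 6.12] [cite: VoisinHodgeI2002, Thm. 6.25 and Thm. 11.30] [cite: HuybrechtsStellari2005, §1] [cite: MoonenZarhin1999LowDim, Introduction].
-/

noncomputable section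

open CategoryTheory CategoryTheory.Limits AlgebraicGeometry Topology

-- the cell's namespace repeats the summit name (`Summit.HodgeConjecture.HodgeConjecture…`), as in every `Ring2*` file
set_option linter.dupNamespace false

namespace Summit.HodgeConjecture.HodgeConjecture.Ring2.SemiregularRepresentatives

open Literature.AlgebraicGeometry Literature.AlgebraicGeometry.Motives
open Literature.AlgebraicGeometry.HodgeTheory
open Literature.AlgebraicTopology.SingularHomology
open Literature.AlgebraicGeometry.KTheory (IsBoundedVBComplex)
open Literature.Barriers.HodgeConjecture (divisorClassesSpan)
open Summit.Ventures.HSemireg (ObjClass)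

/-! ## §1 At Picard rank one, algebraic classes off the open mid-range slots are on the `θ`-ray -/

/-- **At a variety with `B¹ = ℚ·θ`, a rational algebraic class of degree `2q` lies on `ℂ·θ^q` as soon as `q ≤ 1`, `q ≥ n − 1`, or
`N^q ⊆ D^q ⊗ ℂ` is granted** (`Dᵠ ⊗ ℂ = ℂ·θ^q`, PART V; off the middle range every Hodge class is Lefschetz, PART W's
`mem_algebraicClasses_and_divisorClassesSpan_of_offMidRange`). [cite: vanGeemen1994HodgeAV, §2.4 and Thm. 4.11] [cite: VoisinHodgeI2002, Thm. 6.25 and Thm. 11.30] -/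
theorem exists_eq_smul_cupPowTwo_of_picardRankOne {n : ℕ} {X : SchemeOver ℂ} (hX : IsSmoothProjective n X) {θ : complexBetti X 2}
    (hpic : ∀ b : complexBetti X 2, IsRationalClass b → IsOfHodgeType n X 2 1 1 b → b ∈ ℂ ∙ θ)
    {q : ℕ} (hq : q ≤ 1 ∨ n ≤ q + 1 ∨ algebraicClasses X q ≤ divisorClassesSpan X n q)
    {c : complexBetti X (2 * q)} (hcQ : IsRationalClass c) (hcalg : c ∈ algebraicClasses X q) :
    ∃ t : ℂ, c = t • cupPowTwo θ q := by
  have hD : c ∈ divisorClassesSpan X n q := by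
    rcases hq with hq | hq | hq
    · exact (mem_algebraicClasses_and_divisorClassesSpan_of_offMidRange hX (Or.inl hq) c hcQ
        (isOfHodgeType_of_mem_algebraicClasses_of_isSmoothProjective hX q hcalg)).2
    · exact (mem_algebraicClasses_and_divisorClassesSpan_of_offMidRange hX (Or.inr hq) c hcQ
        (isOfHodgeType_of_mem_algebraicClasses_of_isSmoothProjective hX q hcalg)).2
    · exact hq hcalg
  obtain ⟨t, ht⟩ := Submodule.mem_span_singleton.1 (divisorClassesSpan_le_span_cupPowTwo hpic q hD)
  exact ⟨t, ht.symm⟩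

variable {n : ℕ} {𝒳 S : SchemeOver ℂ} {f : 𝒳 ⟶ S}

/-! ## §2 The per-fibre engine, untwisted -/

/-- **AN UNTWISTED ADMISSIBLE COMPLEX WITH `ch_p = a·W| + c·θᵖ` AT ONE PICARD-RANK-ONE FIBRE IS A K-SR♭∃ DATUM** for the door
`twistedReflexiveClass C Adm` (any admissibility notion `Adm`). Data: a smooth projective family `f` of relative dimension `n`; a global `Θ`
with rational `(1,1)` restrictions; `W` with `(p,p)` restrictions; a fibre `s₁` with `B¹(𝒳_{s₁}) ⊗ ℂ ⊆ ℂ·Θ|_{s₁}` (Picard number one in Hodge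
form) at which `Nʲ ⊆ Dʲ ⊗ ℂ` for the mid-range side slots `2 ≤ j`, `j + 2 ≤ n`, `j ≠ p`; an `Adm`-admissible bounded complex of vector bundles `E•`
on `𝒳_{s₁}` (degrees `I ∋ p`) with `ch_p(E•) = a·W|_{s₁} + c·(Θ|_{s₁})ᵖ`, `a ≠ 0`. Then the K-SR♭∃ conclusion holds: `κ := ch(E•)` with `B₀ = 0`
is an admissible datum (`twistedReflexiveClass_of_untwisted`), its side components are on the `θ`-ray (§1), and PART Z-b §5 applies.
[cite: Bloch1972Semiregularity, Remark (7.5)] [cite: vanGeemen1994HodgeAV, §2.4 and Thm. 4.11] [cite: HuybrechtsStellari2005, §1] -/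
theorem exists_lefAtDatum_of_untwisted_at {C : ChernCharacterBetti} {Adm : PerfectAdmissibility} (hf : IsSmoothProjectiveFamily f n)
    (Θ : complexBetti 𝒳 2) (hΘQ : ∀ s : ComplexPoints S, IsRationalClass (complexBetti.map (fiberι f s) 2 Θ))
    (hΘH : ∀ s : ComplexPoints S, IsOfHodgeType n (fiberOver f s) 2 1 1 (complexBetti.map (fiberι f s) 2 Θ))
    {p : ℕ} (W : complexBetti 𝒳 (2 * p))
    (hWH : ∀ s : ComplexPoints S, IsOfHodgeType n (fiberOver f s) (2 * p) p p (complexBetti.map (fiberι f s) (2 * p) W))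
    {s₁ : ComplexPoints S}
    (hpic : ∀ b : complexBetti (fiberOver f s₁) 2, IsRationalClass b → IsOfHodgeType n (fiberOver f s₁) 2 1 1 b →
      b ∈ ℂ ∙ complexBetti.map (fiberι f s₁) 2 Θ)
    (hN : ∀ j, 2 ≤ j → j + 2 ≤ n → j ≠ p → algebraicClasses (fiberOver f s₁) j ≤ divisorClassesSpan (fiberOver f s₁) n j)
    {I : Finset ℕ} {E : CochainComplex (fiberOver f s₁).left.Modules ℤ} (hE : IsBoundedVBComplex E) (hAdm : Adm n (fiberOver f s₁) I E)
    (hpI : p ∈ I) {a c : ℂ} (ha : a ≠ 0)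
    (hch : chPerfect C (fiberOver f s₁) E hE.isFiniteLocallyFree p =
      a • complexBetti.map (fiberι f s₁) (2 * p) W + c • cupPowTwo (complexBetti.map (fiberι f s₁) 2 Θ) p) :
    ∃ (s₁ : ComplexPoints S) (I : Finset ℕ) (κ : (q : ℕ) → complexBetti (fiberOver f s₁) (2 * q))
      (V : (q : ℕ) → complexBetti 𝒳 (2 * q)) (a : ℂ) (Z : complexBetti 𝒳 (2 * p)),
      p ∈ I ∧ twistedReflexiveClass C Adm n (fiberOver f s₁) I κ ∧ a ≠ 0 ∧
      (∀ s : ComplexPoints S,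
        complexBetti.map (fiberι f s) (2 * p) Z ∈ algebraicClasses (fiberOver f s) p ∧
        complexBetti.map (fiberι f s) (2 * p) Z ∈ divisorClassesSpan (fiberOver f s) n p) ∧
      V p = a • W + Z ∧
      (∀ q ∈ I, κ q = complexBetti.map (fiberι f s₁) (2 * q) (V q)) ∧
      (∀ q ∈ I, ∀ s : ComplexPoints S, IsOfHodgeType n (fiberOver f s) (2 * q) q q (complexBetti.map (fiberι f s) (2 * q) (V q))) := by
  have hX := hf.isSmoothProjective s₁
  -- every side component is on the `θ`-ray
  have hside : ∀ q, q ≠ p → ∃ t : ℂ,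
      chPerfect C (fiberOver f s₁) E hE.isFiniteLocallyFree q = t • cupPowTwo (complexBetti.map (fiberι f s₁) 2 Θ) q := by
    intro q hqp
    refine exists_eq_smul_cupPowTwo_of_picardRankOne hX hpic ?_ (isRationalClass_chPerfect C _ E hE.isFiniteLocallyFree q)
      (chPerfect_mem_algebraicClasses C _ hX E hE.isFiniteLocallyFree q)
    by_cases h1 : q ≤ 1
    · exact Or.inl h1
    · by_cases h2 : n ≤ q + 1
      · exact Or.inr (Or.inl h2)
      · exact Or.inr (Or.inr (hN q (by omega) (by omega) hqp))
  choose t ht using hside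
  -- the scalars: `c` in degree `p`, `t q` elsewhere
  let c' : ℕ → ℂ := fun q ↦ if h : q = p then c else t q h
  refine exists_lefAtDatum_of_pinnedDatum_at (𝒪 := twistedReflexiveClass C Adm) hf Θ hΘQ hΘH W hWH (s₁ := s₁) (I := I)
    (κ := fun q ↦ chPerfect C (fiberOver f s₁) E hE.isFiniteLocallyFree q) (a := a) (c := c') hpI
    (twistedReflexiveClass_of_untwisted E hE hAdm fun q _ ↦ rfl) ha ?_ ?_
  · show chPerfect C (fiberOver f s₁) E hE.isFiniteLocallyFree p = a • _ + c' p • _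
    simp only [c', dif_pos rfl]
    exact hch
  · intro q _ hqp
    show chPerfect C (fiberOver f s₁) E hE.isFiniteLocallyFree q = c' q • _
    simp only [c', dif_neg hqp]
    exact ht q hqp

/-! ## §3 Fourfold pencils, codimension two: no mid-range side slot -/

/-- **THE `(4,2)` CELL AT A PICARD-RANK-ONE FIBRE, PER FIBRE, UNTWISTED**: on a smooth projective family of relative dimension `4`, a global
`Θ` with rational `(1,1)` restrictions, `W` with `(2,2)` restrictions, a fibre `s₁` with `B¹(𝒳_{s₁}) ⊗ ℂ ⊆ ℂ·Θ|_{s₁}`: an `Adm`-admissible bounded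
complex of vector bundles `E•` on `𝒳_{s₁}` (degrees `I ∋ 2`) with `ch₂(E•) = a·W|_{s₁} + c·(Θ|_{s₁})²`, `a ≠ 0`, gives the conclusion of K-SR♭∃ for
`(f, W)` over the door `twistedReflexiveClass C Adm` — NO further hypothesis (the side degrees `0, 1, 3, 4` are off the middle range of a
fourfold). With PART Z-e this is the EXACT per-fibre content of the cell at such fibres. [cite: Bloch1972Semiregularity, Remark (7.5)]
[cite: vanGeemen1994HodgeAV, Thm. 4.11] [cite: BuchweitzFlenner2003, §5 Thm. 5.1] -/
theorem exists_lefAtDatum_of_untwisted_at_fourfold {C : ChernCharacterBetti} {Adm : PerfectAdmissibility} (hf : IsSmoothProjectiveFamily f 4)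
    (Θ : complexBetti 𝒳 2) (hΘQ : ∀ s : ComplexPoints S, IsRationalClass (complexBetti.map (fiberι f s) 2 Θ))
    (hΘH : ∀ s : ComplexPoints S, IsOfHodgeType 4 (fiberOver f s) 2 1 1 (complexBetti.map (fiberι f s) 2 Θ))
    (W : complexBetti 𝒳 (2 * 2))
    (hWH : ∀ s : ComplexPoints S, IsOfHodgeType 4 (fiberOver f s) (2 * 2) 2 2 (complexBetti.map (fiberι f s) (2 * 2) W))
    {s₁ : ComplexPoints S}
    (hpic : ∀ b : complexBetti (fiberOver f s₁) 2, IsRationalClass b → IsOfHodgeType 4 (fiberOver f s₁) 2 1 1 b →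
      b ∈ ℂ ∙ complexBetti.map (fiberι f s₁) 2 Θ)
    {I : Finset ℕ} {E : CochainComplex (fiberOver f s₁).left.Modules ℤ} (hE : IsBoundedVBComplex E) (hAdm : Adm 4 (fiberOver f s₁) I E)
    (h2I : 2 ∈ I) {a c : ℂ} (ha : a ≠ 0)
    (hch : chPerfect C (fiberOver f s₁) E hE.isFiniteLocallyFree 2 =
      a • complexBetti.map (fiberι f s₁) (2 * 2) W + c • cupPowTwo (complexBetti.map (fiberι f s₁) 2 Θ) 2) :
    ∃ (s₁ : ComplexPoints S) (I : Finset ℕ) (κ : (q : ℕ) → complexBetti (fiberOver f s₁) (2 * q))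
      (V : (q : ℕ) → complexBetti 𝒳 (2 * q)) (a : ℂ) (Z : complexBetti 𝒳 (2 * 2)),
      2 ∈ I ∧ twistedReflexiveClass C Adm 4 (fiberOver f s₁) I κ ∧ a ≠ 0 ∧
      (∀ s : ComplexPoints S,
        complexBetti.map (fiberι f s) (2 * 2) Z ∈ algebraicClasses (fiberOver f s) 2 ∧
        complexBetti.map (fiberι f s) (2 * 2) Z ∈ divisorClassesSpan (fiberOver f s) 4 2) ∧
      V 2 = a • W + Z ∧
      (∀ q ∈ I, κ q = complexBetti.map (fiberι f s₁) (2 * q) (V q)) ∧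
      (∀ q ∈ I, ∀ s : ComplexPoints S, IsOfHodgeType 4 (fiberOver f s) (2 * q) q q (complexBetti.map (fiberι f s) (2 * q) (V q))) :=
  exists_lefAtDatum_of_untwisted_at hf Θ hΘQ hΘH W hWH hpic (fun j hj hjn hjp ↦ absurd (show j = 2 by omega) hjp) hE hAdm h2I ha hch

/-- **The necessary side at a Picard-rank-one FOURFOLD is pinned and untwisted**: the `(4,2)` stub demands, on a copy of every complex abelian
fourfold `X` with `B¹(X) = ℚ·θ` in Hodge form and every rational algebraic `w ∉ ℂ·θ²` (a Weil class, where algebraic), an AdmTw-admissible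
bounded complex of vector bundles `E•` with `ch₂(E•) = e^*(a·w + c·θ²)`, `a ≠ 0` (PART Z-e + the pin `D² ⊗ ℂ = ℂ·θ²`).
[cite: vanGeemen1994HodgeAV, Thm. 4.11] [cite: Bloch1972Semiregularity, Remark (7.5)] -/
theorem exists_untwisted_pinned_fourfold_of_firstCell_fourfoldMiddleTw
    (h : ∀ C : ChernCharacterBetti, LefAtExceptionalRegimeAt (twistedReflexiveClass C
      (fun n X₀ I E => Summit.Ventures.HSemireg.gluableSigmaAdmissible n X₀ I E ∨ bfSingleAdmissible n X₀ I E)) 4 2)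
    (C : ChernCharacterBetti) (X : SchemeOver ℂ) (hX : ∃ A : AbelianVariety ℂ, A.dim = 4 ∧ Nonempty (A.X ≅ X)) (θ : complexBetti X 2)
    (hpic : ∀ b : complexBetti X 2, IsRationalClass b → IsOfHodgeType 4 X 2 1 1 b → b ∈ ℂ ∙ θ)
    (w : complexBetti X (2 * 2)) (hwQ : IsRationalClass w) (hwalg : w ∈ algebraicClasses X 2) (hw : w ∉ ℂ ∙ cupPowTwo θ 2) :
    ∃ (X' : SchemeOver ℂ) (e : X' ≅ X) (I : Finset ℕ) (E : CochainComplex X'.left.Modules ℤ) (hE : IsBoundedVBComplex E) (a c : ℂ),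
      2 ∈ I ∧ (Summit.Ventures.HSemireg.gluableSigmaAdmissible 4 X' I E ∨ bfSingleAdmissible 4 X' I E) ∧ a ≠ 0 ∧
      chPerfect C X' E hE.isFiniteLocallyFree 2 = complexBetti.map e.hom (2 * 2) (a • w + c • cupPowTwo θ 2) := by
  have hD : divisorClassesSpan X 4 2 ≤ ℂ ∙ cupPowTwo θ 2 := divisorClassesSpan_le_span_cupPowTwo hpic 2
  have hwD : w ∉ divisorClassesSpan X 4 2 := fun hw' ↦ hw (hD hw')
  obtain ⟨X', e, I, E, hE, a, z', h2I, hAdm, ha, -, hzD, hch⟩ := exists_untwisted_of_firstCell_fourfoldMiddleTw h C X hX w hwQ hwalg hwD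
  obtain ⟨c, hc⟩ := Submodule.mem_span_singleton.1 (hD hzD)
  exact ⟨X', e, I, E, hE, a, c, h2I, hAdm, ha, by rw [hch, ← hc]⟩

end Summit.HodgeConjecture.HodgeConjecture.Ring2.SemiregularRepresentatives

end
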